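/-
Copyright: H21 programme, solo seat `solo-RiemannHypothesis-informed` (session 6).
-/
import Mathlib
import Literature.NumberTheory.LFunctions.WeilMellinBounds
import Literature.NumberTheory.Sieve.FriedlanderIwaniecPrimesPoisson
import Summits.RiemannHypothesis.RiemannHypothesis.Theorems.SoloInformedPlateau

/-!
# The comb bump and its flat transform (solo-informed, T39b)

The test-function input of the "price of a companion" theorem (T39).  With the plateau bump
`χ = b₁ = windowPlateau 1` (smooth, even, `0 ≤ χ ≤ 1`, `χ(0) = 1`, `supp χ ⊆ [-1, 1]`) and the
Dirichlet-type comb factor `D_J(u) = 1 + 2 ∑_{1 ≤ n ≤ J} cos(π n u)` we form the **comb bump**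

  `φ_J = χ · D_J`  (real, even, smooth, `supp ⊆ [-1, 1]`),

whose Laplace transform `Φ_J(μ) = ∫ φ_J(u) e^{μu} du` is the comb sum
`Φ_J(μ) = ∑_{|n| ≤ J} X(μ + iπn)` of translates of `X(μ) = ∫ χ(u) e^{μu} du`
(`combXform_eq`).  This file proves the structural facts and the two pointwise bounds on `X` in
the closed strip `|Re μ| ≤ 1/2` that drive everything:

* `‖X(μ)‖ ≤ C_χ / (1 + (Im μ)²)`, `C_χ = weilDecayConst χ` (`norm_chiXform_le`);
* `‖X(μ)‖ · |Im μ|^q ≤ L_q`, `L_q = weilL1(χ^{(q)})` (`norm_chiXform_mul_pow_le`), from the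
  `q`-fold integration by parts `(χ^{(q)})^(s) = (-(s - 1/2))^q χ^(s)`.

The Poisson flatness `Φ_J ≈ 2` on the core and the comb-weight majorants are in
`SoloInformedCombFlat`.
-/

noncomputable section

open Real MeasureTheory Filter Complex Set Literature.NumberTheory.LFunctions
open scoped Topology ContDiff ComplexConjugate

namespace Summit.RiemannHypothesis.RiemannHypothesis.Theorems

/-! ## Iterated integration by parts for `weilMellin` -/

namespace Companion

/-- Iterated derivatives of test functions are test functions. -/
theorem isWeilTest_iteratedDeriv {g : ℝ → ℂ} (hg : IsWeilTest g) :
    ∀ n : ℕ, IsWeilTest (iteratedDeriv n g)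
  | 0 => by simpa using hg
  | n + 1 => by
    rw [iteratedDeriv_succ]
    exact (isWeilTest_iteratedDeriv hg n).deriv

/-- `(g^{(n)})^(s) = (-(s - 1/2))^n ĝ(s)`. -/
theorem weilMellin_iteratedDeriv {g : ℝ → ℂ} (hg : IsWeilTest g) :
    ∀ (n : ℕ) (s : ℂ), weilMellin (iteratedDeriv n g) s = (-(s - 1 / 2)) ^ n * weilMellin g s
  | 0, s => by simp
  | n + 1, s => by
    rw [iteratedDeriv_succ, weilMellin_deriv (isWeilTest_iteratedDeriv hg n),
      weilMellin_iteratedDeriv hg n s]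
    ring

/-- `‖ĝ(s)‖ · ‖s - 1/2‖^n ≤ weilL1 (g^{(n)})` in the closed strip. -/
theorem norm_weilMellin_mul_pow_le {g : ℝ → ℂ} (hg : IsWeilTest g) (n : ℕ) {s : ℂ}
    (hs0 : 0 ≤ s.re) (hs1 : s.re ≤ 1) :
    ‖weilMellin g s‖ * ‖s - 1 / 2‖ ^ n ≤ weilL1 (iteratedDeriv n g) := by
  have h := norm_weilMellin_le_weilL1 (isWeilTest_iteratedDeriv hg n).1.continuous
    (isWeilTest_iteratedDeriv hg n).2 hs0 hs1
  rw [weilMellin_iteratedDeriv hg n s, norm_mul, norm_pow, norm_neg] at h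
  linarith [h]

end Companion

open Companion

/-! ## The bump `χ` and its transform `X` -/

/-- `χ = b₁` as a complex-valued function. -/
def combChi : ℝ → ℂ := fun u ↦ (windowPlateau 1 u : ℂ)

/-- `χ` is smooth. -/
theorem contDiff_combChi : ContDiff ℝ ∞ combChi :=
  Complex.ofRealCLM.contDiff.comp (contDiff_windowPlateau 1)

/-- `χ` is continuous. -/
theorem continuous_combChi : Continuous combChi := contDiff_combChi.continuous

/-- `tsupport χ ⊆ [-1, 1]`. -/
theorem tsupport_combChi_subset : tsupport combChi ⊆ Icc (-1) 1 := by
  refine (closure_mono ?_).trans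
    ((isClosed_Icc.closure_subset_iff).mpr (subset_tsupport _ |>.trans (tsupport_windowPlateau_subset 1)))
  intro t ht
  rw [Function.mem_support] at ht ⊢
  intro h0
  apply ht
  simp [combChi, h0]

/-- `χ` has compact support. -/
theorem hasCompactSupport_combChi : HasCompactSupport combChi :=
  HasCompactSupport.of_support_subset_isCompact isCompact_Icc
    (subset_tsupport _ |>.trans tsupport_combChi_subset)

/-- `χ` is a Weil test function. -/
theorem isWeilTest_combChi : IsWeilTest combChi := ⟨contDiff_combChi, hasCompactSupport_combChi⟩

/-- `χ(0) = 1`. -/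
theorem combChi_zero : combChi 0 = 1 := by
  simp [combChi, windowPlateau_eq_one (a := 1) (t := 0) (by simp)]

/-- `χ(u) = 0` for `|u| ≥ 1`. -/
theorem combChi_eq_zero {u : ℝ} (hu : 1 ≤ |u|) : combChi u = 0 := by
  simp [combChi, windowPlateau_eq_zero hu]

/-- `χ` is even. -/
theorem combChi_neg (u : ℝ) : combChi (-u) = combChi u := by
  simp [combChi, windowPlateau_even]

/-- `‖χ(u)‖ ≤ 1`. -/
theorem norm_combChi_le (u : ℝ) : ‖combChi u‖ ≤ 1 := by
  rw [combChi, Complex.norm_real, Real.norm_of_nonneg (windowPlateau_nonneg 1 u)]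
  exact windowPlateau_le_one 1 u

/-- `X(μ) = ∫ χ(u) e^{μu} du`. -/
def chiXform (μ : ℂ) : ℂ := ∫ u : ℝ, combChi u * cexp (μ * u)

/-- `X(μ) = χ^(μ + 1/2)` in the `weilMellin` normalisation. -/
theorem chiXform_eq_weilMellin (μ : ℂ) : chiXform μ = weilMellin combChi (μ + 1 / 2) := by
  simp [chiXform, weilMellin]

/-- The strip decay constant `C_χ = weilDecayConst χ`. -/
def combC : ℝ := weilDecayConst combChi

/-- `C_χ ≥ 0`. -/
theorem combC_nonneg : 0 ≤ combC := weilDecayConst_nonneg _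

/-- The `q`-th tail constant `L_q = weilL1 (χ^{(q)})`. -/
def combL (q : ℕ) : ℝ := weilL1 (iteratedDeriv q combChi)

/-- `L_q ≥ 0`. -/
theorem combL_nonneg (q : ℕ) : 0 ≤ combL q := weilL1_nonneg _

/-- `‖X(μ)‖ ≤ C_χ / (1 + (Im μ)²)` for `|Re μ| ≤ 1/2`. -/
theorem norm_chiXform_le {μ : ℂ} (hμ : |μ.re| ≤ 1 / 2) :
    ‖chiXform μ‖ ≤ combC / (1 + μ.im ^ 2) := by
  rw [chiXform_eq_weilMellin]
  have h0 : 0 ≤ (μ + 1 / 2).re := by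
    have := (abs_le.mp hμ).1; simp; linarith
  have h1 : (μ + 1 / 2).re ≤ 1 := by
    have := (abs_le.mp hμ).2; simp; linarith
  have h := norm_weilMellin_le isWeilTest_combChi h0 h1
  have him : (μ + 1 / 2).im = μ.im := by simp
  rw [him] at h
  exact h

/-- `‖X(μ)‖ · |Im μ|^q ≤ L_q` for `|Re μ| ≤ 1/2`. -/
theorem norm_chiXform_mul_pow_le (q : ℕ) {μ : ℂ} (hμ : |μ.re| ≤ 1 / 2) :
    ‖chiXform μ‖ * |μ.im| ^ q ≤ combL q := by
  rw [chiXform_eq_weilMellin]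
  have h0 : 0 ≤ (μ + 1 / 2).re := by
    have := (abs_le.mp hμ).1; simp; linarith
  have h1 : (μ + 1 / 2).re ≤ 1 := by
    have := (abs_le.mp hμ).2; simp; linarith
  have h := norm_weilMellin_mul_pow_le isWeilTest_combChi q h0 h1
  have hs : μ + 1 / 2 - 1 / 2 = μ := by ring
  rw [hs] at h
  refine le_trans ?_ h
  refine mul_le_mul_of_nonneg_left ?_ (norm_nonneg _)
  exact pow_le_pow_left₀ (abs_nonneg _) (Complex.abs_im_le_norm μ) q

/-- `‖X(μ)‖ ≤ L_q / |Im μ|^q` for `|Re μ| ≤ 1/2`, `Im μ ≠ 0`. -/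
theorem norm_chiXform_le_div (q : ℕ) {μ : ℂ} (hμ : |μ.re| ≤ 1 / 2) (him : μ.im ≠ 0) :
    ‖chiXform μ‖ ≤ combL q / |μ.im| ^ q := by
  rw [le_div_iff₀ (by positivity)]
  exact norm_chiXform_mul_pow_le q hμ

/-! ## The comb bump `φ_J` -/

/-- The comb factor `D_J(u) = 1 + 2 ∑_{n < J} cos(π (n+1) u)`. -/
def combFactor (J : ℕ) (u : ℝ) : ℝ :=
  1 + 2 * ∑ n ∈ Finset.range J, Real.cos (π * (n + 1) * u)

/-- The comb bump `φ_J = χ · D_J` (real-valued). -/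
def combBump (J : ℕ) (u : ℝ) : ℝ := windowPlateau 1 u * combFactor J u

/-- The comb bump as a complex test function. -/
def combTest (J : ℕ) : ℝ → ℂ := fun u ↦ (combBump J u : ℂ)

/-- `D_J` is even. -/
theorem combFactor_neg (J : ℕ) (u : ℝ) : combFactor J (-u) = combFactor J u := by
  unfold combFactor
  congr 1; congr 1
  exact Finset.sum_congr rfl fun n _ ↦ by rw [mul_neg, Real.cos_neg]

/-- `φ_J` is even. -/
theorem combBump_neg (J : ℕ) (u : ℝ) : combBump J (-u) = combBump J u := by
  unfold combBump; rw [windowPlateau_even, combFactor_neg]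

/-- `φ_J` is even (complex form). -/
theorem combTest_neg (J : ℕ) (u : ℝ) : combTest J (-u) = combTest J u := by
  simp [combTest, combBump_neg]

/-- `φ_J` is real. -/
theorem conj_combTest (J : ℕ) (u : ℝ) : conj (combTest J u) = combTest J u := by
  simp [combTest]

/-- `D_J` is smooth. -/
theorem contDiff_combFactor (J : ℕ) : ContDiff ℝ ∞ (combFactor J) := by
  unfold combFactor
  refine contDiff_const.add (contDiff_const.mul ?_)
  refine ContDiff.sum fun n _ ↦ ?_
  exact (contDiff_const.mul contDiff_id).cos

/-- `φ_J` is smooth. -/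
theorem contDiff_combTest (J : ℕ) : ContDiff ℝ ∞ (combTest J) := by
  unfold combTest combBump
  exact Complex.ofRealCLM.contDiff.comp ((contDiff_windowPlateau 1).mul (contDiff_combFactor J))

/-- `φ_J` is continuous. -/
theorem continuous_combTest (J : ℕ) : Continuous (combTest J) := (contDiff_combTest J).continuous

/-- `tsupport φ_J ⊆ [-1, 1]`. -/
theorem tsupport_combTest_subset (J : ℕ) : tsupport (combTest J) ⊆ Icc (-1) 1 := by
  refine (closure_mono ?_).trans
    ((isClosed_Icc.closure_subset_iff).mpr (subset_tsupport _ |>.trans (tsupport_windowPlateau_subset 1)))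
  intro t ht
  rw [Function.mem_support] at ht ⊢
  intro h0
  apply ht
  simp [combTest, combBump, h0]

/-- `φ_J` has compact support. -/
theorem hasCompactSupport_combTest (J : ℕ) : HasCompactSupport (combTest J) :=
  HasCompactSupport.of_support_subset_isCompact isCompact_Icc
    (subset_tsupport _ |>.trans (tsupport_combTest_subset J))

/-- `φ_J` is a Weil test function. -/
theorem isWeilTest_combTest (J : ℕ) : IsWeilTest (combTest J) :=
  ⟨contDiff_combTest J, hasCompactSupport_combTest J⟩

/-- `φ_J(0) = 2J + 1`. -/
theorem combTest_zero (J : ℕ) : combTest J 0 = 2 * J + 1 := by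
  simp [combTest, combBump, combFactor, windowPlateau_eq_one (a := 1) (t := 0) (by simp)]
  ring

/-! ## The transform `Φ_J` as a comb sum -/

/-- `Φ_J(μ) = ∫ φ_J(u) e^{μu} du`. -/
def combXform (J : ℕ) (μ : ℂ) : ℂ := ∫ u : ℝ, combTest J u * cexp (μ * u)

/-- `Φ_J(μ) = φ_J^(μ + 1/2)` in the `weilMellin` normalisation. -/
theorem combXform_eq_weilMellin (J : ℕ) (μ : ℂ) :
    combXform J μ = weilMellin (combTest J) (μ + 1 / 2) := by
  simp [combXform, weilMellin]

/-- the `n`-th tooth frequency `π (n + 1)` -/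
def tooth (n : ℕ) : ℝ := π * (n + 1)

/-- `0 < π(n+1)`. -/
theorem tooth_pos (n : ℕ) : 0 < tooth n := by unfold tooth; positivity

/-- `χ e^{μu}` is integrable. -/
private theorem integrable_chi_mul_cexp (μ : ℂ) :
    Integrable fun u : ℝ ↦ combChi u * cexp (μ * u) :=
  (continuous_combChi.mul (by fun_prop)).integrable_of_hasCompactSupport
    hasCompactSupport_combChi.mul_right

/-- Pointwise expansion `φ_J(u) e^{μu} = χ e^{μu} + ∑_{n<J} (χ e^{(μ + iπ(n+1))u} + χ e^{(μ - iπ(n+1))u})`. -/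
theorem combTest_mul_cexp (J : ℕ) (μ : ℂ) (u : ℝ) :
    combTest J u * cexp (μ * u) = combChi u * cexp (μ * u) +
      ∑ n ∈ Finset.range J, (combChi u * cexp ((μ + tooth n * I) * u) +
        combChi u * cexp ((μ - tooth n * I) * u)) := by
  have key : ∀ n : ℕ, cexp ((μ + tooth n * I) * u) + cexp ((μ - tooth n * I) * u) =
      2 * ((Real.cos (tooth n * u) : ℝ) : ℂ) * cexp (μ * u) := by
    intro n
    have e1 : (μ + tooth n * I) * u = μ * u + ((tooth n * u : ℝ) : ℂ) * I := by push_cast; ring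
    have e2 : (μ - tooth n * I) * u = μ * u + (-((tooth n * u : ℝ) : ℂ)) * I := by push_cast; ring
    rw [e1, e2, Complex.exp_add, Complex.exp_add, Complex.exp_mul_I, Complex.exp_mul_I,
      Complex.cos_neg, Complex.sin_neg, Complex.ofReal_cos]
    ring
  have hpair : ∀ n : ℕ, combChi u * cexp ((μ + tooth n * I) * u) +
      combChi u * cexp ((μ - tooth n * I) * u) =
      (2 * combChi u * cexp (μ * u)) * ((Real.cos (tooth n * u) : ℝ) : ℂ) := by
    intro n; rw [← mul_add, key n]; ring
  simp_rw [hpair]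
  rw [← Finset.mul_sum]
  have hcos : ∀ n : ℕ, Real.cos (π * (n + 1) * u) = Real.cos (tooth n * u) := fun n ↦ by
    unfold tooth; ring_nf
  simp only [combTest, combBump, combFactor, combChi, hcos]
  push_cast
  ring

/-- **Comb decomposition.** `Φ_J(μ) = X(μ) + ∑_{n<J} (X(μ + iπ(n+1)) + X(μ - iπ(n+1)))`. -/
theorem combXform_eq (J : ℕ) (μ : ℂ) :
    combXform J μ = chiXform μ +
      ∑ n ∈ Finset.range J, (chiXform (μ + tooth n * I) + chiXform (μ - tooth n * I)) := by
  have hI : ∀ ν : ℂ, Integrable (fun u : ℝ ↦ combChi u * cexp (ν * u)) := integrable_chi_mul_cexp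
  have hIpair : ∀ n ∈ Finset.range J, Integrable (fun u : ℝ ↦
      combChi u * cexp ((μ + tooth n * I) * u) + combChi u * cexp ((μ - tooth n * I) * u)) :=
    fun n _ ↦ (hI _).add (hI _)
  have hIsum : Integrable (fun u : ℝ ↦ ∑ n ∈ Finset.range J,
      (combChi u * cexp ((μ + tooth n * I) * u) + combChi u * cexp ((μ - tooth n * I) * u))) :=
    integrable_finsetSum _ hIpair
  unfold combXform chiXform
  simp_rw [combTest_mul_cexp J μ]
  rw [integral_add (hI μ) hIsum]
  congr 1
  rw [integral_finsetSum _ hIpair]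
  exact Finset.sum_congr rfl fun n _ ↦ integral_add (hI _) (hI _)

/-- `Φ_J(-μ) = Φ_J(μ)` (evenness of `φ_J`). -/
theorem combXform_neg (J : ℕ) (μ : ℂ) : combXform J (-μ) = combXform J μ := by
  unfold combXform
  rw [← integral_neg_eq_self (fun u : ℝ ↦ combTest J u * cexp (μ * u)) volume]
  refine integral_congr_ae (Eventually.of_forall fun u ↦ ?_)
  simp only [combTest_neg]
  congr 1
  push_cast
  ring_nf

/-- `Φ_J(conj μ) = conj Φ_J(μ)` (reality of `φ_J`). -/
theorem combXform_conj (J : ℕ) (μ : ℂ) : combXform J (conj μ) = conj (combXform J μ) := by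
  unfold combXform
  rw [← integral_conj]
  refine integral_congr_ae (Eventually.of_forall fun u ↦ ?_)
  simp only [map_mul, conj_combTest, ← Complex.exp_conj, Complex.conj_ofReal]

/-- `X(conj μ) = conj X(μ)`. -/
theorem chiXform_conj (μ : ℂ) : chiXform (conj μ) = conj (chiXform μ) := by
  unfold chiXform
  rw [← integral_conj]
  refine integral_congr_ae (Eventually.of_forall fun u ↦ ?_)
  simp only [map_mul, combChi, Complex.conj_ofReal, ← Complex.exp_conj]

/-- `Φ_J(0) = ∫ φ_J = X(0) + 2 ∑_{n<J} Re X(iπ(n+1))` is real; more useful: `Φ_J(μ)` is real for real `μ`. -/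
theorem combXform_ofReal_im (J : ℕ) (x : ℝ) : (combXform J x).im = 0 := by
  have h := combXform_conj J x
  rw [Complex.conj_ofReal] at h
  exact Complex.conj_eq_iff_im.mp h.symm

end Summit.RiemannHypothesis.RiemannHypothesis.Theorems
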